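import Summits.HodgeConjecture.HodgeConjecture.Theorems.F0P2oXThetaOwnClass              -- ★ K1c (F0P2-p05 p827560): `isIrreducible_xThetaCM`, `isSmooth_xThetaCM`; ★ `F0P2oThetaTypeOwnClass.isIrreducible_piH ∕ isSmooth_piH ∕ _piG`
import Literature.NumberTheory.Rogawski1990.SupercuspidalNotSphericalCofinite           -- ★ `Representation.IsSupercuspidal.comp_continuousMulEquiv`, `IrrClass.IsSupercuspidal.comap`
import HarnessLib

/-!
# Crux `H413`, programme P2 — CLS (node N1-glue of topic T7): a SUPERCUSPIDAL local theta type `X_v(μ, ε, χ_f)` HAS a supercuspidal class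
# on `U(H)(L⁺_v)` which «is the theta type»

Cell hodgecm-mathlib (D-0151), FLOOR 0, crux H413 = stmt-HodgeConjecture-24833; helper for the LOCAL HALF of print letter #75 D7α
(`GelbartRogawski1991.xiEnvelope_nonsplit_isThetaType`) along typ-T7b's Lines draft `F0/P2/Lines-draft/T7b_LocalThetaDichotomy.lean` (v1.5), whose
registered-shape stub CLS `StubThetaClassOfSupercuspidal` (:290–303) this file closes BY NAME (`stubThetaClassOfSupercuspidal_holds`, body VERBATIM — it is
spelled entirely in ★ Literature vocabulary: `xThetaCM`, `ThetaTypeAtCM`, `cmDatum`, `Representation.IsSupercuspidal`, `IrrClass.IsSupercuspidal`; no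
`Lines` name occurs), and whose K3 assembler `k3_of_letters` consumes it.  Desk «=» F0P2-plan (g8) 2026-08-31T16:31:54Z (b)(B).

THE MATHEMATICS [GelbartRogawski1991 §1.4 p. 451 L1–4 «πˢ(ϱ_v) is supercuspidal»; Liu2021 App. D Lem. D.1 (1)].  For the CM frame `ᵗ(c̄ g) H g = diag dV`,
Liu's local theta type `X_v(μ, ε, χ_f)` (★ `xThetaCM`, a representation of `U(diag dV)(L⁺_v)`) is irreducible and smooth for continuous unitary `χ_f`
(★ K1c `isIrreducible_xThetaCM`, `isSmooth_xThetaCM`).  Put `πH := X_v ∘ κ_v⁻¹` on `localPi … H v` (★ `localCongr`, the composition printed in ★ `ThetaTypeAtCM`)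
and `πs := ⟦πH ∘ localPiEquiv_v⁻¹⟧ ∈ Irr(U(H)(L⁺_v))` (★ `IrrClass.comap (localPiEquiv … v).symm`).  Then:
* (§1) if `X_v` is supercuspidal (Harish-Chandra: smooth matrix coefficients compactly supported modulo the centre, ★ `Representation.IsSupercuspidal`) so are
  `πH`, the `Gqs`-avatar `πG` of the K1 sub-line (`isSupercuspidal_piG`, for the N4-in-house ∕ K3 consumers) and the class `πs` — supercuspidality transports
  along isomorphisms of topological groups (★ `IsSupercuspidal.comp_continuousMulEquiv`, ★ `IrrClass.IsSupercuspidal.comap`);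
* (§2) `πs` IS the theta type: `ThetaTypeAtCM … ε v πs` — the read-back `comap (localPiEquiv v) πs = ⟦πH⟧` (★ `IrrClass.comap_comap_symm`), a constituent of an
  irreducible `τ` is `≃ τ`, and isotypic components see the type only up to `≃` (★ `F0P2iThetaTypeCriterion.isotypicComponent_eq_top_of_isConstituentOf_of_mk_eq`);
* (§3) the closer `stubThetaClassOfSupercuspidal_holds` (the non-split hypothesis of the stub is not used).
THEOREMS ONLY (no `def`, no named fact, no `sorry`); unconditional.  HC_CM is proved only modulo the printed citations until rung 0 closes; nothing here
proves a letter.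

## References
* [GelbartRogawski1991] S. Gelbart, J. Rogawski, Invent. Math. 105 (1991): §1.4 pp. 450–451 L1–4; §5.1 (5.1.1), Lem. 5.1.2 p. 466.
* [Liu2021] Y. Liu, Camb. J. Math. 9 (2021): Def. 4.11 (l. 2090–2096); App. D Lem. D.1 (1) (l. 5226–5229).
* [HarishChandra1970] Harish-Chandra (notes by van Dijk), LNM 162, Part I §3 p. 9.  [BushnellHenniart2006] Grundlehren 335: §1.1, §2, §10.1.
* [MoeglinVignerasWaldspurger1987] LNM 1291, Chap. 3 §IV.4.  [PlatonovRapinchuk1994] §2.3 (local congruences).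
-/

set_option autoImplicit false
-- the mandated namespace has the single-problem summit's repeated segment (`HodgeConjecture.HodgeConjecture`)
set_option linter.dupNamespace false

noncomputable section

open NumberField IsDedekindDomain MeasureTheory
open scoped Matrix

open Literature.NumberTheory Literature.NumberTheory.Automorphic Literature.NumberTheory.Automorphic.UnitaryGroup
open Literature.NumberTheory.Automorphic.IdeleClassGroup
open Literature.NumberTheory.Automorphic.Liu2021 Literature.NumberTheory.Automorphic.Liu2021.Def411WeilCarriers
open Literature.NumberTheory.GaloisRepresentations
open Literature.NumberTheory.Rogawski1990
open Literature.NumberTheory.GelbartRogawski1991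

namespace Summit.HodgeConjecture.HodgeConjecture.Cruxes.H413.F0P2oThetaClassOfSupercuspidal

section Transport

variable (L : Type) [Field L] [NumberField L] [IsCMField L] (H : Matrix (Fin 3) (Fin 3) L) {n' : ℕ} (e₁ : Fin 3 × Fin 1 ≃ Fin n')
    (dV : Fin 3 → L) (hdV : ∀ i, IsCMField.complexConj L (dV i) = dV i) (hdV0 : ∀ i, dV i ≠ 0) (g : GL (Fin 3) L)
    (hg : ((g : Matrix (Fin 3) (Fin 3) L).map (cmConjRingHom L))ᵀ * H * (g : Matrix (Fin 3) (Fin 3) L) = Matrix.diagonal dV)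
    (μ : Literature.NumberTheory.Automorphic.IdeleClassGroup L →ₜ* Circle) (hμ : IsConjugateSymplectic L μ)
    (χf : UnitaryGroup.finAdelicOne (↥(maximalRealSubfield L)) L (IsCMField.complexConj L) →* ℂˣ) (ε : (↥(maximalRealSubfield L))ˣ)
    (v : HeightOneSpectrum (𝓞 ↥(maximalRealSubfield L)))

include hg

/-! ## §1 Supercuspidality transports from `X_v` to `πH = X_v ∘ κ_v⁻¹`, to the `Gqs`-avatar `πG`, and to the class `πs` on `U(H)(L⁺_v)` -/

set_option synthInstance.maxHeartbeats 400000 in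
set_option maxHeartbeats 8000000 in
/-- **`πH := X_v(μ,ε,χ_f) ∘ κ_v⁻¹` on `localPi … H v` is SUPERCUSPIDAL when `X_v` is** (`κ_v⁻¹` is an isomorphism of topological groups, ★ `localCongr`;
★ `IsSupercuspidal.comp_continuousMulEquiv`). [cite: HarishChandra1970, Part I §3 p. 9] [cite: BushnellHenniart2006, §10.1] [cite: PlatonovRapinchuk1994, §2.3] -/
theorem isSupercuspidal_piH (hsc : (xThetaCM L e₁ dV hdV hdV0 μ hμ χf ε v).IsSupercuspidal) :
    Representation.IsSupercuspidal
      ((xThetaCM L e₁ dV hdV hdV0 μ hμ χf ε v :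
        localPi L (IsCMField.complexConj L) 3 (Matrix.diagonal dV) v →* _).comp
      (localCongr L (IsCMField.complexConj L) g one_ne_zero
        (by rw [one_smul]; exact hg) v).symm.toMulEquiv.toMonoidHom) :=
  hsc.comp_continuousMulEquiv (localCongr L (IsCMField.complexConj L) g one_ne_zero (by rw [one_smul]; exact hg) v).symm

set_option synthInstance.maxHeartbeats 400000 in
set_option maxHeartbeats 8000000 in
/-- **`πG := X_v(μ,ε,χ_f) ∘ κ_v⁻¹ ∘ ((cmDatumLocalCongr v T).trans (localPiEquiv v)⁻¹)` on `Gqs L v = U(Φ₃)(L⁺_v)` — the K1 sub-line's spelling (★ K1c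
`isIrreducible_xThetaGqs`) — is SUPERCUSPIDAL when `X_v` is**, for any form congruence `ᵗT̄ H_v T = a Φ₃` (both maps are isomorphisms of topological groups).
For the N4-in-house ∕ K3 consumers. [cite: HarishChandra1970, Part I §3 p. 9] [cite: BushnellHenniart2006, §10.1] [cite: Rogawski1990, §12.2 p. 173] -/
theorem isSupercuspidal_piG (T : GL (Fin 3) (UnitaryGroup.LocalRing L v)) (a : UnitaryGroup.LocalRing L v) (ha : IsUnit a)
    (h : formCongr (conjLocal L (IsCMField.complexConj L) v) T (H.map (algebraMap L (UnitaryGroup.LocalRing L v))) =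
      a • (Matrix.of fun i j : Fin 3 => if i.val + j.val + 1 = 3 then (1 : L) else 0).map (algebraMap L (UnitaryGroup.LocalRing L v)))
    (hsc : (xThetaCM L e₁ dV hdV hdV0 μ hμ χf ε v).IsSupercuspidal) :
    Representation.IsSupercuspidal
      (((xThetaCM L e₁ dV hdV hdV0 μ hμ χf ε v :
        localPi L (IsCMField.complexConj L) 3 (Matrix.diagonal dV) v →* _).comp
      (localCongr L (IsCMField.complexConj L) g one_ne_zero (by rw [one_smul]; exact hg) v).symm.toMulEquiv.toMonoidHom).comp
      ((cmDatumLocalCongr L v T ha h).trans (localPiEquiv L (IsCMField.complexConj L) 3 H v).symm).toMulEquiv.toMonoidHom) :=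
  (isSupercuspidal_piH L H e₁ dV hdV hdV0 g hg μ hμ χf ε v hsc).comp_continuousMulEquiv
    ((cmDatumLocalCongr L v T ha h).trans (localPiEquiv L (IsCMField.complexConj L) 3 H v).symm)

set_option synthInstance.maxHeartbeats 400000 in
set_option maxHeartbeats 8000000 in
/-- **The class `πs := ⟦πH ∘ localPiEquiv_v⁻¹⟧ ∈ Irr(U(H)(L⁺_v))` is SUPERCUSPIDAL when `X_v` is** (given irreducibility and smoothness of `X_v` to form the class;
★ `IrrClass.IsSupercuspidal.comap`). [cite: HarishChandra1970, Part I §3 p. 9] [cite: BushnellHenniart2006, §1.1, §10.1] -/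
theorem isSupercuspidal_comap_mk_piH (hirr : Representation.IsIrreducible (xThetaCM L e₁ dV hdV hdV0 μ hμ χf ε v))
    (hsm : Representation.IsSmooth (xThetaCM L e₁ dV hdV hdV0 μ hμ χf ε v)) (hsc : (xThetaCM L e₁ dV hdV hdV0 μ hμ χf ε v).IsSupercuspidal) :
    (IrrClass.comap (localPiEquiv L (IsCMField.complexConj L) 3 H v).symm
        (IrrClass.mk
          { V := _,
            ρ := ((xThetaCM L e₁ dV hdV hdV0 μ hμ χf ε v :
                  localPi L (IsCMField.complexConj L) 3 (Matrix.diagonal dV) v →* _).comp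
                (localCongr L (IsCMField.complexConj L) g one_ne_zero
                  (by rw [one_smul]; exact hg) v).symm.toMulEquiv.toMonoidHom),
            isIrreducible := F0P2oThetaTypeOwnClass.isIrreducible_piH L H e₁ dV hdV hdV0 g hg μ hμ χf ε v hirr,
            isSmooth := F0P2oThetaTypeOwnClass.isSmooth_piH L H e₁ dV hdV hdV0 g hg μ hμ χf ε v hsm })).IsSupercuspidal :=
  IrrClass.IsSupercuspidal.comap _ ((IrrClass.isSupercuspidal_mk _).2 (isSupercuspidal_piH L H e₁ dV hdV hdV0 g hg μ hμ χf ε v hsc))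

/-! ## §2 The class `πs` IS the theta type `X_v ∘ κ_v⁻¹` -/

set_option synthInstance.maxHeartbeats 400000 in
set_option maxHeartbeats 8000000 in
/-- **`ThetaTypeAtCM … ε v πs` for `πs := ⟦πH ∘ localPiEquiv_v⁻¹⟧`**: read back on `localPi … H v` the class is `⟦πH⟧` (★ `IrrClass.comap_comap_symm`); a constituent of an
IRREDUCIBLE `τ` is `≃ τ`, and `τ`-isotypic representations are then `πH = X_v ∘ κ_v⁻¹`-isotypic (★ `F0P2iThetaTypeCriterion.isotypicComponent_eq_top_of_isConstituentOf_of_mk_eq`).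
[cite: GelbartRogawski1991, §5.1 (5.1.1), Lem. 5.1.2 p. 466] [cite: BushnellHenniart2006, §1.1, §2] -/
theorem thetaTypeAtCM_comap_mk_piH (hirr : Representation.IsIrreducible (xThetaCM L e₁ dV hdV hdV0 μ hμ χf ε v))
    (hsm : Representation.IsSmooth (xThetaCM L e₁ dV hdV hdV0 μ hμ χf ε v)) :
    ThetaTypeAtCM L H e₁ dV hdV hdV0 g hg μ hμ χf ε v
      (IrrClass.comap (localPiEquiv L (IsCMField.complexConj L) 3 H v).symm
        (IrrClass.mk
          { V := _,
            ρ := ((xThetaCM L e₁ dV hdV hdV0 μ hμ χf ε v :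
                  localPi L (IsCMField.complexConj L) 3 (Matrix.diagonal dV) v →* _).comp
                (localCongr L (IsCMField.complexConj L) g one_ne_zero
                  (by rw [one_smul]; exact hg) v).symm.toMulEquiv.toMonoidHom),
            isIrreducible := F0P2oThetaTypeOwnClass.isIrreducible_piH L H e₁ dV hdV hdV0 g hg μ hμ χf ε v hirr,
            isSmooth := F0P2oThetaTypeOwnClass.isSmooth_piH L H e₁ dV hdV hdV0 g hg μ hμ χf ε v hsm })) := by
  intro T' _ _ τ hτ hc W' _ _ ρ' htop
  haveI := hτ
  -- read-back `comap e (comap e⁻¹ ⟦πH⟧) = ⟦πH⟧` (★ `IrrClass.comap_comap_symm`; by `exact`, not `rw`: the two spellings `(cmDatum L 3 H).Local v` ∕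
  -- `↥(«local» …)` of `U(H)(L⁺_v)` are defeq but not syntactically equal)
  exact F0P2iThetaTypeCriterion.isotypicComponent_eq_top_of_isConstituentOf_of_mk_eq
    (IrrClass.comap_comap_symm (localPiEquiv L (IsCMField.complexConj L) 3 H v) _).symm (Representation.Equiv.refl _) hc ρ' htop

end Transport

/-! ## §3 The stub CLS `StubThetaClassOfSupercuspidal` of typ-T7b's Lines draft, CLOSED BY NAME -/

set_option synthInstance.maxHeartbeats 400000 in
set_option maxHeartbeats 8000000 in
/-- **Stub CLS `StubThetaClassOfSupercuspidal` (typ-T7b Lines draft `F0/P2/Lines-draft/T7b_LocalThetaDichotomy.lean` v1.5 :290–303, statement VERBATIM).**  For the CM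
frame `ᵗ(c̄ g) H g = diag dV`, a conjugate-symplectic `μ`, a continuous unitary `χ_f`, a (non-split) finite `v` and a line `ε`: if `X_v(μ, ε, χ_f)` (★ `xThetaCM`) is
supercuspidal then there is a supercuspidal class `πs ∈ Irr(U(H)(L⁺_v))` with `ThetaTypeAtCM … ε v πs` — namely `πs := ⟦X_v ∘ κ_v⁻¹ ∘ localPiEquiv_v⁻¹⟧`
(§1 `isSupercuspidal_comap_mk_piH` + §2 `thetaTypeAtCM_comap_mk_piH` over ★ K1c `isIrreducible_xThetaCM` ∕ `isSmooth_xThetaCM`; the non-split hypothesis is not used).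
Consumed by the draft's `k3_of_letters`. [cite: GelbartRogawski1991, §1.4 p. 451 L1–4] [cite: MoeglinVignerasWaldspurger1987, Chap. 3 §IV.4] [cite: Liu2021, App. D Lem. D.1 (1)] -/
theorem stubThetaClassOfSupercuspidal_holds :
  ∀ (L : Type) [Field L] [NumberField L] [IsCMField L] (H : Matrix (Fin 3) (Fin 3) L) (hH : (H.map (cmConjRingHom L))ᵀ = H) (hHd : IsUnit H.det)
    {n' : ℕ} (e₁ : Fin 3 × Fin 1 ≃ Fin n') (dV : Fin 3 → L) (hdV : ∀ i, IsCMField.complexConj L (dV i) = dV i) (hdV0 : ∀ i, dV i ≠ 0) (g : GL (Fin 3) L)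
    (hg : ((g : Matrix (Fin 3) (Fin 3) L).map (cmConjRingHom L))ᵀ * H * (g : Matrix (Fin 3) (Fin 3) L) = Matrix.diagonal dV),
    ∀ (μ : Literature.NumberTheory.Automorphic.IdeleClassGroup L →ₜ* Circle) (hμ : IsConjugateSymplectic L μ)
      (χf : UnitaryGroup.finAdelicOne (↥(maximalRealSubfield L)) L (IsCMField.complexConj L) →* ℂˣ),
      Continuous χf → (∀ z, ‖((χf z : ℂˣ) : ℂ)‖ = 1) →
      ∀ (v : HeightOneSpectrum (𝓞 ↥(maximalRealSubfield L))),
        (∀ w : PlacesOver L v, IsCMField.complexConj L • w.1 = w.1) →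
        ∀ (ε : (↥(maximalRealSubfield L))ˣ),
          (xThetaCM L e₁ dV hdV hdV0 μ hμ χf ε v).IsSupercuspidal →
          ∃ πs : IrrClass ((cmDatum L 3 H).Local v), πs.IsSupercuspidal ∧ ThetaTypeAtCM L H e₁ dV hdV hdV0 g hg μ hμ χf ε v πs := by
  intro L _ _ _ H _ _ n' e₁ dV hdV hdV0 g hg μ hμ χf hcont hunit v _ ε hsc
  exact ⟨_, isSupercuspidal_comap_mk_piH L H e₁ dV hdV hdV0 g hg μ hμ χf ε v
      (F0P2oXThetaOwnClass.isIrreducible_xThetaCM L e₁ dV hdV hdV0 μ hμ χf hcont hunit ε v)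
      (F0P2oXThetaOwnClass.isSmooth_xThetaCM L e₁ dV hdV hdV0 μ hμ χf hcont hunit ε v) hsc,
    thetaTypeAtCM_comap_mk_piH L H e₁ dV hdV hdV0 g hg μ hμ χf ε v
      (F0P2oXThetaOwnClass.isIrreducible_xThetaCM L e₁ dV hdV hdV0 μ hμ χf hcont hunit ε v)
      (F0P2oXThetaOwnClass.isSmooth_xThetaCM L e₁ dV hdV hdV0 μ hμ χf hcont hunit ε v)⟩

end Summit.HodgeConjecture.HodgeConjecture.Cruxes.H413.F0P2oThetaClassOfSupercuspidal

end
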